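import Literature.NumberTheory.LFunctions.DirichletLRiemannHypothesisUpTo
import Literature.NumberTheory.LFunctions.NoRealZeroPrintedFrontier
import Literature.NumberTheory.LFunctions.CertifiedZetaIsolationStepFive
import Literature.NumberTheory.LFunctions.RHWave0NumericalRHProofs
import Literature.NumberTheory.LFunctions.GeneralizedRH
import HarnessLib

/-!
# Printed certified ranges that follow from other printed certified ranges (instrument provenance)

Topic `Literature/NumberTheory/LFunctions`; namespace `Literature.NumberTheory.LFunctions`. PROVED
implications only (no definition, no named fact): three published certified computations that the tree
carries as named facts AS PRINTED (D-0014) are logical consequences of two other named facts of the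
tree, so that — for the purpose of counting independent computational hypotheses behind a kernel
statement ("instrument provenance" of the parity-realchar / RH columns) — they add no debt beyond
Platt's two computations:

* `bmor2021_lemma61a_of_platt2016 : platt2016_theorem71 → bmor2021_lemma61a` — Bennett–Martin–O'Bryant–
  Rechnitzer, Math. Comp. 90 (2021), Lemma 6.1 (a) («Let `1 < q < 935` … all of the zeros of `L(s, χ)`
  with real part between `0` and `1` and imaginary part between `−2(e⁶π − q)/q` and `2(e⁶π − q)/q` have
  real part equal to `1/2`») is inside Platt's GRH verification (Math. Comp. 85 (2016), Thm. 10.1 of the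
  journal = arXiv Thm. 7.1: primitive `χ` of modulus `1 < q ≤ 400 000` to height `plattHeight q ≥ 10⁸/q`):
  `2(e⁶π − q)/q < 2e⁶π/q < 3300/q < 10⁸/q`. (The analogous `rumely1993_theorem4_of_platt2016` is in
  `DirichletLRiemannHypothesisUpTo.lean`.)
* `chua2005_theorem11_of_platt2016 : platt2016_theorem71 → platt2016_theorem72 → chua2005_theorem11` —
  Chua, Math. Comp. 74 (2005), Thm. 1.1 (no real zero in `(0, 1)` for even real primitive `χ` of conductor
  `≤ 2·10⁵`) is the even half of the tree's `noRealZeroUpTo_platt` (`NoRealZeroUpTo 400000` from Platt's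
  Thms. 7.1/7.2, `NoRealZeroUpTo.lean`) restricted to `2·10⁵ ≤ 4·10⁵` (`noRealZeroEvenUpTo_platt`,
  `NoRealZeroEvenUpTo.anti_level` of `NoRealZeroPrintedFrontier.lean`).
* `platt2017_theorem51_re_of_platt_trudgian : platt_trudgian_numerical_rh → (∀ ρ, ζ ρ = 0 → ρ non-trivial →
  |Im ρ| ≤ 30 610 046 000 → Re ρ = 1/2)` — the `ℜρ = ½` half of Platt, Math. Comp. 86 (2017), Thm. 5.1
  (`platt2017_theorem51`, `CertifiedZetaIsolationStepFive.lean`) follows from Platt–Trudgian, Bull. LMS 53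
  (2021), Thm. 1 (RH to height `3 000 175 332 800`, the tree's `platt_trudgian_numerical_rh` = rh.S35): a
  non-trivial zero lies in the open strip (`riemannZeta_eq_zero_iff_of_re_nonpos`,
  `riemannZeta_ne_zero_of_one_le_re`), where rh.S35 in its two-sided strip form
  (`platt_trudgian_numerical_rh_iff_inStrip`) applies since `3.06·10¹⁰ ≤ 3.0·10¹²`; and
  `platt2017_theorem51_iff_simple_of_platt_trudgian`: GIVEN rh.S35, Theorem 5.1 is equivalent to its
  simplicity half alone — which is therefore the only content of `platt2017_theorem51` independent of
  `platt_trudgian_numerical_rh` (the source of the latter, §2: «we made no attempt to isolate zeroes to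
  any more precision than was absolutely necessary», counts sign changes, so simplicity of the
  `103 800 788 359` zeros below `3.06·10¹⁰` remains Platt 2017's own certificate).

After this file the named computation facts of record for the degree-`≤ 1` certified ranges relate as
follows (PROVED arrows; everything else pairwise independent as typed): `platt2016_theorem71 ⇒
rumely1993_theorem4, bmor2021_lemma61a`; `platt2016_theorem71 ∧ platt2016_theorem72 ⇒ NoRealZeroUpTo 400000
⇒ chua2005_theorem11`; `platt_trudgian_numerical_rh` (`↔ riemannHypothesisUpTo_platt_trudgian`, `Iff.rfl`,
`RHWave0NumericalRHProofs.lean`) `⇒` the RH half of `platt2017_theorem51`; `Buthe2016_thm2 ∧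
riemannHypothesisUpTo_platt_trudgian ⇒ PlattTrudgian2021_cor1` (`ButhePartialRH.lean`). Not implied by
any of these (independent instruments): `watkins2004_theorem` (odd real `χ`, `d ≤ 3·10⁸`),
`luZamanZhao2026_theorem11`, `languasco2023_theorem1`, the zero TABLES `rumely1993_tables_*`, and the
simplicity half of `platt2017_theorem51`.

## References

* [BennettMartinOBryantRechnitzer2021] M. A. Bennett, G. Martin, K. O'Bryant, A. Rechnitzer, *Counting
  zeros of Dirichlet L-functions*, Math. Comp. 90 (2021) 1455–1482, Lemma 6.1 (a) (arXiv:2005.02989v1).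
* [Platt2016GRH] D. J. Platt, *Numerical computations concerning the GRH*, Math. Comp. 85 (2016)
  3009–3027, Theorems 10.1–10.2 p. 3026 (= arXiv:1305.3087v1 Theorems 7.1–7.2).
* [Chua2005RealZeros] K. S. Chua, *Real zeros of Dedekind zeta functions of real quadratic fields*,
  Math. Comp. 74 (2005) 1457–1470, Theorem 1.1.
* [Platt2017] D. J. Platt, *Isolating some non-trivial zeros of zeta*, Math. Comp. 86 (2017) 2449–2467,
  Theorem 5.1 p. 2456.
* [PlattTrudgian2021] D. J. Platt, T. S. Trudgian, *The Riemann hypothesis is true up to 3·10¹²*,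
  Bull. Lond. Math. Soc. 53 (2021) 792–797, Theorem 1 and §2 (held: paper:arxiv-2004.09765, p. 2).
-/

noncomputable section

open Complex

namespace Literature.NumberTheory.LFunctions

/-! ### Bennett–Martin–O'Bryant–Rechnitzer 2021, Lemma 6.1 (a) from Platt 2016, Theorem 7.1 -/

/-- `e⁶ < 405` (`e < 2.7182818286`, `Real.exp_one_lt_d9`). [folklore] -/
private theorem exp_six_lt : Real.exp 6 < 405 := by
  have h := Real.exp_one_lt_d9
  have h0 : 0 < Real.exp 1 := Real.exp_pos 1
  have e : Real.exp 6 = Real.exp 1 ^ 6 := by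
    rw [← Real.exp_nat_mul]; norm_num
  rw [e]
  have h6 : Real.exp 1 ^ 6 < 2.7182818286 ^ 6 := pow_lt_pow_left₀ h h0.le (by norm_num)
  have : (2.7182818286 : ℝ) ^ 6 < 405 := by norm_num
  linarith

/-- BMOR's height `2(e⁶π − q)/q` is below Platt's `10⁸/q` for every modulus `q ≥ 1`.
[cite: BennettMartinOBryantRechnitzer2021, Lemma 6.1 (a)] -/
theorem bmor_height_le_platt {q : ℕ} (hq : 0 < q) :
    2 * (Real.exp 6 * Real.pi - q) / q ≤ 10 ^ 8 / (q : ℝ) := by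
  have hq0 : (0 : ℝ) < q := by exact_mod_cast hq
  have hπ := Real.pi_lt_four
  have he := exp_six_lt
  have hepos : 0 < Real.exp 6 := Real.exp_pos 6
  refine div_le_div_of_nonneg_right ?_ hq0.le
  nlinarith [Real.pi_pos]

/-- `10⁸/q ≤ plattHeight q` (both parities of `q`). [cite: Platt2016GRH, Theorem 10.1 p. 3026] -/
theorem div_le_plattHeight' (q : ℕ) : 10 ^ 8 / (q : ℝ) ≤ plattHeight q := by
  unfold plattHeight
  split_ifs <;> exact le_max_left _ _

/-- **BMOR 2021, Lemma 6.1 (a), as a COROLLARY of Platt 2016, Theorem 7.1:** every modulus of the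
lemma satisfies `1 < q < 935 ≤ 400 000`, and its height `2(e⁶π − q)/q` is at most `10⁸/q ≤ plattHeight q`;
so the printed 2021 statement (typed verbatim as the named fact `bmor2021_lemma61a`) follows from
`platt2016_theorem71` — it adds no independent computational debt beyond Platt's GRH verification.
[cite: BennettMartinOBryantRechnitzer2021, Lemma 6.1 (a)] [cite: Platt2016GRH, Theorem 10.1 p. 3026] -/
theorem bmor2021_lemma61a_of_platt2016 (hP : platt2016_theorem71) : bmor2021_lemma61a := by
  intro q _ hq1 hq χ hχ
  have hq' : q ≤ 400000 := by omega
  exact (hP q hq1 hq' χ hχ).mono_of_le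
    ((bmor_height_le_platt (q := q) (by omega)).trans (div_le_plattHeight' q))

/-! ### Chua 2005, Theorem 1.1 from Platt 2016, Theorems 7.1–7.2 -/

/-- **Chua 2005, Theorem 1.1, as a COROLLARY of Platt 2016, Theorems 7.1–7.2:** Platt's verification
gives `NoRealZeroEvenUpTo 400000` (`noRealZeroEvenUpTo_platt`), and Chua's range `2·10⁵` lies inside it;
so the printed 2005 statement (the named fact `chua2005_theorem11 = NoRealZeroEvenUpTo 200000`) adds no
independent computational debt beyond Platt's. (Chua's METHOD — Davenport's cycle sums for even real
characters — is of course independent; only the printed RANGE is superseded.)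
[cite: Chua2005RealZeros, Theorem 1.1] [cite: Platt2016GRH, Theorems 10.1–10.2 p. 3026] -/
theorem chua2005_theorem11_of_platt2016 (h71 : platt2016_theorem71) (h72 : platt2016_theorem72) :
    chua2005_theorem11 :=
  NoRealZeroEvenUpTo.anti_level (noRealZeroEvenUpTo_platt h71 h72) (by norm_num)

/-- The printed wide frontier of record needs only Platt's and Watkins' computations: Chua's theorem is
implied. [cite: Chua2005RealZeros, Theorem 1.1] [cite: Platt2016GRH, Theorems 10.1–10.2 p. 3026] -/
theorem noRealZeroUpTo_of_platt_implies_watkins_chua_range (h71 : platt2016_theorem71)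
    (h72 : platt2016_theorem72) (hW : watkins2004_theorem) : NoRealZeroUpTo 200000 :=
  noRealZeroUpTo_of_watkins_chua hW (chua2005_theorem11_of_platt2016 h71 h72)

/-! ### Platt 2017, Theorem 5.1 (the `ℜρ = ½` half) from Platt–Trudgian 2021, Theorem 1 -/

/-- A non-trivial zero of `ζ` (a zero other than `−2(n+1)`, `n ∈ ℕ`) lies in the open critical strip
`0 < Re ρ < 1` (Hadamard–de la Vallée Poussin on `Re s ≥ 1`, `riemannZeta_ne_zero_of_one_le_re`; the
functional equation on `Re s ≤ 0`, `riemannZeta_eq_zero_iff_of_re_nonpos`; Titchmarsh §2.12).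
[cite: Titchmarsh1986, §2.12] -/
theorem re_mem_Ioo_of_nontrivial_zero {ρ : ℂ} (hζ : riemannZeta ρ = 0)
    (htriv : ∀ n : ℕ, ρ ≠ -2 * ((n : ℂ) + 1)) : 0 < ρ.re ∧ ρ.re < 1 := by
  refine ⟨?_, ?_⟩
  · by_contra hle
    obtain ⟨n, hn⟩ := (riemannZeta_eq_zero_iff_of_re_nonpos (not_lt.mp hle)).mp hζ
    exact htriv n (by rw [hn])
  · by_contra hge
    exact riemannZeta_ne_zero_of_one_le_re (not_lt.mp hge) hζ

/-- **Platt 2017, Theorem 5.1, its `ℜρ = ½` half, as a COROLLARY of Platt–Trudgian 2021, Theorem 1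
(rh.S35):** every non-trivial zero `ρ` of `ζ` with `|ℑρ| ≤ 3.0610046·10¹⁰` has `ℜρ = ½`, from RH up to
height `3 000 175 332 800 ≥ 30 610 046 000` in its two-sided strip form
(`platt_trudgian_numerical_rh_iff_inStrip`). So of the named fact `platt2017_theorem51` only the
SIMPLICITY of these zeros is computational debt independent of `platt_trudgian_numerical_rh` (Platt–Trudgian,
§2: «once we had found a sign change … we merely counted it and moved on» — their computation certifies
`ℜρ = ½`, not simplicity, cf. `platt2017_theorem51_iff_simple_of_platt_trudgian`).
[cite: Platt2017, Theorem 5.1 p. 2456] [cite: PlattTrudgian2021, Theorem 1] -/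
theorem platt2017_theorem51_re_of_platt_trudgian (h : platt_trudgian_numerical_rh) :
    ∀ ρ : ℂ, riemannZeta ρ = 0 → (∀ n : ℕ, ρ ≠ -2 * ((n : ℂ) + 1)) → |ρ.im| ≤ 30610046000 →
      ρ.re = 1 / 2 := by
  intro ρ hζ htriv hT
  obtain ⟨h0, h1⟩ := re_mem_Ioo_of_nontrivial_zero hζ htriv
  exact platt_trudgian_numerical_rh_iff_inStrip.mp h ρ hζ h0 h1 (hT.trans (by norm_num))

/-- **Given rh.S35, Platt 2017 Theorem 5.1 is equivalent to its simplicity half**: under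
`platt_trudgian_numerical_rh`, `platt2017_theorem51 ↔ (every non-trivial zero ρ of ζ with
|ℑρ| ≤ 3.0610046·10¹⁰ is simple, ζ'(ρ) ≠ 0)`. [cite: Platt2017, Theorem 5.1 p. 2456]
[cite: PlattTrudgian2021, Theorem 1] -/
theorem platt2017_theorem51_iff_simple_of_platt_trudgian (h : platt_trudgian_numerical_rh) :
    platt2017_theorem51 ↔
      ∀ ρ : ℂ, riemannZeta ρ = 0 → (∀ n : ℕ, ρ ≠ -2 * ((n : ℂ) + 1)) → |ρ.im| ≤ 30610046000 →
        deriv riemannZeta ρ ≠ 0 :=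
  ⟨fun h51 ρ hζ htriv hT => (h51 ρ hζ htriv hT).1,
    fun hs ρ hζ htriv hT => ⟨hs ρ hζ htriv hT, platt2017_theorem51_re_of_platt_trudgian h ρ hζ htriv hT⟩⟩

/-- Conversely (no hypothesis): Theorem 5.1 gives RH in the two-sided strip form up to its own height,
`RiemannHypothesisInStripUpTo 30610046000` (companion of `platt2017_theorem51.rh_upTo`, the upper
half-strip form). [cite: Platt2017, Theorem 5.1 p. 2456] -/
theorem platt2017_theorem51.inStrip (h51 : platt2017_theorem51) :
    RiemannHypothesisInStripUpTo 30610046000 := by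
  intro ρ hζ h0 _ hT
  refine (h51 ρ hζ (fun n hn => ?_) hT).2
  have := congrArg Complex.re hn
  simp at this
  have : (0 : ℝ) ≤ n := n.cast_nonneg
  linarith

end Literature.NumberTheory.LFunctions

end
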